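import Literature.Probability.RandomPlanarGeometry.HexSAWBridgeCubeSum
import Literature.Probability.RandomPlanarGeometry.HexSAWHammersleyWelshExplicit
import HarnessLib

/-!
# The cube-less series `Σ_T B_T(π/3)/T` converges under ANY polynomial decay of the critical bridge masses

Topic `Literature/Probability/RandomPlanarGeometry`; lane «pcv-sawmu» (literature seat lit-1), a
companion to `HexSAWBridgeCubeSum.lean`.

The named fact `YangBaxter.GlazmanManolescu2019_prop11` of `YangBaxterSAWFacts.lean`,
`Σ_{T ≥ 1} B_T(π/3)/T < ∞`, is Glazman–Manolescu's Proposition 1.1, eq. (3), quoted WITHOUT the cube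
(A. Glazman, I. Manolescu, *Self-avoiding walk on `ℤ²` with Yang–Baxter weights: universality of critical
fugacity and 2-point function*, Ann. Inst. Henri Poincaré Probab. Stat. 56 (2020), arXiv:1708.00395,
Proposition 1.1: "We have `Σ_{T ≥ 1} (1/T)(B_T(π/3))³ < ∞` (3)"). The printed eq. (3) is the tree theorem
`YangBaxter.GlazmanManolescu2019_eq3`; the cube-less statement is strictly stronger and is not what
Glazman–Manolescu prove. It is nevertheless TRUE, as a consequence of D. Krachun, C. Panagiotis,
*Quantitative sub-ballisticity of self-avoiding walk on the hexagonal lattice*, Ann. Probab. (2026),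
arXiv:2310.17299, **Theorem 2** ("Let `ε = 10^{-10}`. For every `T ≥ 1` we have `B_T ≤ 100 · T^{-ε}`"):
`B_T(π/3) ≤ B_T(x_c) ≤ C T^{-η}` gives `Σ_T B_T(π/3)/T ≤ C Σ_T T^{-1-η} < ∞`.

This file proves exactly that implication, with the decay as the tree's hypothesis SCHEMA
`BridgeDecay C η` (`∀ T ≥ 1, HV.stripBlim T ≤ C · T^{-η}`, `HexSAWHammersleyWelshExplicit.lean`):

* `HV.summable_stripBlim_succ_div_of_bridgeDecay` — `0 < η → BridgeDecay C η → Summable (T ↦ B_{T+1}(x_c)/(T+1))`;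
* **`YangBaxter.GlazmanManolescu2019_prop11_of_bridgeDecay`** —
  `0 < η → BridgeDecay C η → GlazmanManolescu2019_prop11`.

Krachun–Panagiotis's Theorem 2 with an explicit exponent is at present a Summits-side theorem
(`…HexConjecture.RootLocality.KPExplicit.stripBlim_decay_explicit`, packaged there as
`bridgeDecay_explicit : BridgeDecay 200 (7/10⁹)` in `HexHWStretchedFromKPExplicit.lean`), which Literature may
not import; fed to the theorem below it yields `GlazmanManolescu2019_prop11` in one line on that side, and the
Literature discharge `GlazmanManolescu2019_prop11_holds` becomes that one line once the Krachun–Panagiotis chain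
lives under `Literature/`. No named fact is introduced here; `BridgeDecay` is a hypothesis schema.
-/

noncomputable section

open Real Finset Filter Topology
open scoped ENNReal

namespace Literature.Probability.RandomPlanarGeometry.SAW

namespace HV

/-- Under a polynomial decay `B_T(x_c) ≤ C T^{-η}` (`η > 0`) of Duminil-Copin–Smirnov's critical bridge
partition functions, the cube-less series `Σ_{T ≥ 1} B_T(x_c)/T` converges (comparison with `C Σ T^{-1-η}`).
[cite: KrachunPanagiotis2026, Theorem 2 (shape of the hypothesis)] -/
theorem summable_stripBlim_succ_div_of_bridgeDecay {C η : ℝ} (hη : 0 < η) (h : BridgeDecay C η) :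
    Summable fun T : ℕ => stripBlim (T + 1) / ((T + 1 : ℕ) : ℝ) := by
  have hg : Summable fun T : ℕ => C * ((T + 1 : ℕ) : ℝ) ^ (-(1 + η)) :=
    (summable_nat_add_iff (f := fun n : ℕ => C * (n : ℝ) ^ (-(1 + η))) 1).2
      ((Real.summable_nat_rpow.2 (by linarith)).mul_left C)
  refine Summable.of_nonneg_of_le (fun T => ?_) (fun T => ?_) hg
  · exact div_nonneg (stripBlim_nonneg (by omega)) (Nat.cast_nonneg _)
  · have hx : (0 : ℝ) < ((T + 1 : ℕ) : ℝ) := by positivity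
    have hB : stripBlim (T + 1) ≤ C * ((T + 1 : ℕ) : ℝ) ^ (-η) := h (T + 1) (by omega)
    calc stripBlim (T + 1) / ((T + 1 : ℕ) : ℝ)
        ≤ C * ((T + 1 : ℕ) : ℝ) ^ (-η) / ((T + 1 : ℕ) : ℝ) := div_le_div_of_nonneg_right hB hx.le
      _ = C * ((T + 1 : ℕ) : ℝ) ^ (-(1 + η)) := by
          rw [show -(1 + η) = -η + (-1 : ℝ) by ring, Real.rpow_add hx, Real.rpow_neg_one]
          ring

end HV

namespace YangBaxter

/-- **The cube-less `Σ_{T ≥ 1} B_T(π/3)/T < ∞` (`GlazmanManolescu2019_prop11`) follows from any polynomial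
decay of the critical bridge masses of the hexagonal lattice**: `B_T(π/3) ≤ B_T(x_c)`
(`bridgePartitionFunction_pi_div_three_le_stripBlim`) and `Σ_T B_T(x_c)/T < ∞` under `BridgeDecay C η`,
`η > 0`. With Krachun–Panagiotis's Theorem 2 (`B_T ≤ 100·T^{-10^{-10}}` for all `T ≥ 1`; in the tree
`BridgeDecay 200 (7/10⁹)`, Summits side) the hypothesis is met.
[cite: KrachunPanagiotis2026, Theorem 2] [cite: GlazmanManolescu2019, Proposition 1.1, eq. (3) (the cube-less mis-quote)] -/
theorem GlazmanManolescu2019_prop11_of_bridgeDecay {C η : ℝ} (hη : 0 < η) (h : BridgeDecay C η) :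
    GlazmanManolescu2019_prop11 := by
  unfold GlazmanManolescu2019_prop11
  set f : ℕ → ℝ := fun t => HV.stripBlim (t + 1) / ((t + 1 : ℕ) : ℝ) with hf
  have hf0 : ∀ t, 0 ≤ f t := fun t => div_nonneg (stripBlim_nonneg (by omega)) (Nat.cast_nonneg _)
  have hsum : Summable f := HV.summable_stripBlim_succ_div_of_bridgeDecay hη h
  have hle : ∀ T : ℕ, bridgePartitionFunction (T + 1) (fun _ => π / 3) / (T + 1 : ℝ≥0∞) ≤
      ENNReal.ofReal (f T) := by
    intro T
    have h1 := bridgePartitionFunction_pi_div_three_le_stripBlim (T := T + 1) (by omega)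
    have hT0 : (0 : ℝ) < (T : ℝ) + 1 := by positivity
    calc bridgePartitionFunction (T + 1) (fun _ => π / 3) / (T + 1 : ℝ≥0∞)
        ≤ ENNReal.ofReal (HV.stripBlim (T + 1)) / (T + 1 : ℝ≥0∞) := by
          gcongr
      _ = ENNReal.ofReal (f T) := by
          rw [hf]
          dsimp only
          rw [Nat.cast_add_one, ENNReal.ofReal_div_of_pos hT0,
            ENNReal.ofReal_add (Nat.cast_nonneg T) zero_le_one, ENNReal.ofReal_natCast, ENNReal.ofReal_one]
  calc (∑' T : ℕ, bridgePartitionFunction (T + 1) (fun _ => π / 3) / (T + 1 : ℝ≥0∞))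
      ≤ ∑' T : ℕ, ENNReal.ofReal (f T) := ENNReal.tsum_le_tsum hle
    _ = ENNReal.ofReal (∑' T : ℕ, f T) := (ENNReal.ofReal_tsum_of_nonneg hf0 hsum).symm
    _ < ⊤ := ENNReal.ofReal_lt_top

end YangBaxter

end Literature.Probability.RandomPlanarGeometry.SAW
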